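import Summits.BirchSwinnertonDyer.Rank1Residual.F1Sign2.SelmerUnitsAtTwo
import Literature.NumberTheory.EllipticCurves.TamagawaProofs
import Mathlib.RingTheory.DedekindDomain.SelmerGroup
import HarnessLib

/-!
# Cell `bsd-f1-sign2`, lens `-desc` g11 (MEMO-desc §19): «THE LOCAL KUMMER IMAGE AT `2` HAS EXACTLY `φ₂′` ODD DIRECTIONS» —
# valuation parities of `δ₂(W(ℚ₂)) ⊂ ker N ⊂ (L_W ⊗ ℚ₂)^×/□` above `2`, all reduction types: DESC-§19-X (lead), -B, -N, -G

STATEMENTS ONLY (carriers with bodies; the four theorem-candidates DESC-§19-X `KummerParityRankEqUnramifiedDefectAtTwo` (LEAD, exact formula),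
DESC-§19-B `KummerParityRankLeAtTwo` (the bound DESC-§18-P `RelaxedSelmerUnitPigeonholeAtTwo` of `F1Sign2/SelmerUnitsAtTwo.lean` consumes at
`p = 2`), DESC-§19-N `LowerNiceIffUpperNiceAtTwo` (Yoo–Yu niceness symmetry), DESC-§19-G `KummerClassesAreUnitClassesAtGoodTwo` (support, KNOWN)
as plain `def … : Prop` — theorem-grade in-print ASSEMBLIES per REF1, nothing asserted; ONE proved bookkeeping theorem G ⟸ B; no `@[conjecture]`
(none of the four is an open law), no named Literature fact, no `sorry`, no `instance` — `[NumberField (twoDivisionAlgebra W)]` is a BINDER as in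
`SelmerUnitsAtTwo.lean`).

TYPER FILING (seat `bsd-f1-sign2-ty` g7; CANDIDATES.md rows DESC-§19-X / -B / -N / -G; -desc g11 CANDIDATES-delta HOME/INBOX.md 2026-08-28T03:44:07Z,
D-desc-19): bodies VERBATIM from the planner's `HOME/MEMO-desc-data/g11/Sketch-v14.lean` **fdf194c11524bc20** (MEMO-desc.md 7ba492848fcaac13 §19,
l.1049–1204; data `MEMO-desc-data/g11/` SHA16SUMS; planner: `lean check` rc 0 · 0 err · 0 warn · 0 sorry, BC7 `Probe-v14.out` 4/4 CLEAN). Typer edits =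
this header; the Sketch-v13 duplicate carriers `twoDivisionAlgebra` / `InExplicitLocalKummerImageAtTwo` DROPPED and IMPORTED from the landed
`F1Sign2/SelmerUnitsAtTwo.lean` (p599927; identical signatures `W` / `W p α` — REF1 §67 n4); REF1 §67 n1 (coinvariant wording of the bound) folded into
DESC-§19-B's docstring; REF1 §67 n2 realised as the PROVED `kummerClassesAreUnitClassesAtGoodTwo_of_kummerParityRankLeAtTwo` (G ⟸ B through the
tree's discharged `WeierstrassCurve.localTamagawaNumber_eq_one_of_hasGoodReduction_holds`, `Literature/…/TamagawaProofs.lean`); n3 (ˣ-binders kept),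
n5 (`Fact (Irreducible …)` kept), n6 (the `1 + 4𝔭_w ⊂ □` sentence is in the carrier docstring) need no text change. CENSUS of record (planner's, quoted;
kit tag `bsd-frontier-data`, j297517 full run 9.3 core-h + j297751/j297873/j297874 step-(ii) algebra, `MEMO-desc-data/g11/j297517-numbers.json`,
output sha16 9d5d0fedbac837f7): 1 736 029 odd-torsion Cremona curves `N < 5·10⁵` (0 errors) → rk = φ′ **1 736 029 / 1 736 029** at `p = 2` with engine A
(`idealval`) and 1 736 029 / 1 736 029 with engine B (`ℚ₂`-factor norms), 1 308 773 / 1 308 773 = Stoll's formula at odd `p` (control); bound (B)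
violations 0 / 1 736 029; good curves 367 370 with 0 odd classes (G); engine cross-checks 3 044 802 / 3 044 802 rows (basis complete, rank A = B,
parity multisets, `dim(K+N)` oracle A = B, `#primes = d + 1`); step-(ii) identities 528 / 528 over 14 fields; examples `φ′ = 1`: 1888b1 (III), 3776h1 (I₀*),
822f1 (I₂); `φ′ = 0` with `v₂(c₂) ≥ 1`: 1080d1 (III), 406b1 (I₄ non-split); `φ′ = 2`: 27584k1 (I₄*). REF1-AUDIT-v1 §67 (2026-08-28T03:27:24Z; evidence
`HOME/REF1-data/b67/`, Sketch-v14 fdf194c11524bc20 probed verbatim, probe rc 0, 4 sorries = the anchors, 87.8 s): **DESC-§19-X, -N, -B, -G SURVIVE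
THEOREM-GRADE** (in-print assembly: Lang–Hensel on the Néron model `H¹(ℚ₂^nr/ℚ₂, W(ℚ₂^nr)) ≅ H¹(𝔽₂, Φ₂)` [Milne ADT I.3.8 / McCallum], Tate local
duality = maximal isotropy of `δ₂` [Poonen–Rains Prop. 4.10–4.11], cup product on `ker N` = sum of Hilbert symbols [Shapiro + cores], `(u_w, β)_w =
(−1)^{v_w(β)}` [Serre, Local Fields XIV §3]; X the master statement, B/G its corollaries, N the Yoo–Yu symmetry); A1 read-back of every carrier ✓
(`Nat.card (PrimesOverTwo W) − 1` junk-free since `#{w ∣ 2} ≥ 1`; α-junk at `0` neutralised by the ˣ-binders); BC7 4/4 CLEAN; axioms standard;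
**CLEARED for -ty to type as plain defs**, nits n1–n6 docstring-level (folded as above); -desc g11 ACK 03:45:32Z. REF2-PLACEMENT: v16 §44 (d)
(b75380ddc2d9a8e1) had recorded the `p = 2` clause of DESC-§18-P «NOT LOCATED in print» (Yoo–Yu 2022 reach even primes only under lower/upper-NICE,
Def. 1.5 / Thm. 1.6; Brumer–Kramer 1977 semistable/good; for `v ∤ 2` Schaefer–Stoll 2004 Lemma 3.1 + remark, p. 1212); -desc g11's own check before typing
(INBOX 03:44:07Z → -ref2): no statement of X/N at `v ∣ 2` found (BK77 = the good case G, KNOWN via Yoo–Yu Thm 1.10 / BPT 2021 (†.iv)); D-desc-ref2-19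
(placement of §19.2 / (C3) / (C5)) is item (C) of -ref2 g16's work list (STATUS 03:54:05Z) — its verdict is folded into this header at the next touch.
Cell currency (REF1 §67, -desc g11 03:45:32Z correction): PARTITION: none moved; beyond-print theorem: **no** (an assembly of printed lemmas; the
`p = 2` clause is the cell's cleanest «not located in print, proved on paper here» item — -desc/REF2 decide whether it merits a Literature note).
bears_on: DESC-§18-P (`RelaxedSelmerUnitPigeonholeAtTwo`, whose `p = 2` input is DESC-§19-B), O-∞′ (MEMO-desc §17.12), `stmt-BirchSwinnertonDyer-19099`
via the -desc rows; answers Yoo–Yu 2022's sharpness question (after Thm 1.11) in the form «nice at `2` ⟺ `φ₂′ = 0`».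

Planner's summary (verbatim from Sketch-v14):
# Sketch-v14 (planner `-desc` g11, MEMO-desc §19): the LOCAL LEMMA AT `2` behind DESC-§18-P — valuation parities of the
local Kummer image `δ₂(W(ℚ₂)) ⊂ ker N ⊂ (L_W ⊗ ℚ₂)^×/□` at the primes of `L_W` above `2`, for ALL reduction types.

THEOREM (L-exact; proof MEMO-desc §19.2, four steps: Lang–Hensel on the Néron model `H¹(ℚ₂^nr/ℚ₂, W(ℚ₂^nr)) ≅ H¹(𝔽₂, Φ₂)`
[Milne ADT I.3.8 proof; McCallum 1990], Tate local duality = maximal isotropy of `δ₂(W(ℚ₂))` for the Weil-pairing cup product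
[Poonen–Rains 2012, Prop. 4.10 of arXiv:1009.0287], the cup product on `ker N` is the sum of the Hilbert symbols of the `L_w` [Shapiro + cores], and the
Hilbert symbol against the unramified class `u_w` is `(−1)^{v_w}` [Serre, Local Fields XIV §3]):
  `rank_{𝔽₂} {(v_w(α) mod 2)_{w ∣ 2} : α ∈ δ₂(W(ℚ₂))} = φ₂′(W) := dim_{𝔽₂} Im( H¹(𝔽₂, W[2](ℚ₂^nr)) → H¹(𝔽₂, Φ₂(𝔽̄₂)) )`
  `= dim_{𝔽₂}(δ₂(W(ℚ₂)) + H¹_nr(ℚ₂, W[2])) − dim δ₂(W(ℚ₂))`, hence `≤ min(dim W(ℚ₂)[2], dim Φ₂(𝔽₂)[2]) ≤ v₂(c₂(W))`, and `= 0` at good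
  reduction (every Kummer class above `2` is a UNIT class) — the `p = 2` clause REF2 v16 §44(d) could not locate in print (for `v ∤ 2` the
  analogue is Schaefer–Stoll 2004, Lemma 3.1 and the remark following it, p. 1212; Brumer–Kramer 1977 §3).
CENSUS = BC5 witness (kit, tag bsd-frontier-data, two engines per quantity): see the row docstrings and MEMO-desc §19.4.
Carriers `twoDivisionAlgebra`, `InExplicitLocalKummerImageAtTwo` are VERBATIM from Sketch-v13 (= -ty draft `F1Sign2/SelmerUnitsAtTwo.lean`;
delete the duplicates here when that file lands and import it). New carriers: `PrimesOverTwo`, `kummerParityVectorAtTwo`,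
`IsExplicitUnramifiedClassAtTwo`, `LocSqIndependentAtTwo`. Statements only (`def … : Prop`); nothing asserted; no `sorry`.
-/

noncomputable section

open scoped Classical TensorProduct nonZeroDivisors

open WeierstrassCurve Polynomial NumberField IsDedekindDomain

namespace Summit.BirchSwinnertonDyer.Rank1Residual.F1Sign2

/-- The primes `w` of the ring of integers `𝓞 L_W` lying above `2` (`w ∣ 2`, i.e. `2 ∈ w`); their number is `dim_{𝔽₂} W(ℚ₂)[2] + 1`
(the `ℚ₂`-factors of the cubic `c_W`). [folklore] -/
def PrimesOverTwo (W : WeierstrassCurve ℚ) [Fact (Irreducible (twoDivisionUCubic W))] [NumberField (twoDivisionAlgebra W)] : Type :=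
  {w : HeightOneSpectrum (𝓞 (twoDivisionAlgebra W)) // (2 : 𝓞 (twoDivisionAlgebra W)) ∈ w.asIdeal}

/-- The VALUATION-PARITY VECTOR of `α ∈ L_W^×` at the primes above `2`: `w ↦ v_w(α) mod 2` (Mathlib `HeightOneSpectrum.valuationOfNeZero`,
whose additive logarithm is `−v_w`; the sign is immaterial mod `2`). It depends only on the square class of `α`; it vanishes iff `α` is a
UNIT CLASS above `2` (`α ∈ 𝓞_{L,w}^× · L_w^{×2}` for every `w ∣ 2`). [folklore] -/
def kummerParityVectorAtTwo (W : WeierstrassCurve ℚ) [Fact (Irreducible (twoDivisionUCubic W))] [NumberField (twoDivisionAlgebra W)]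
    (α : (twoDivisionAlgebra W)ˣ) : PrimesOverTwo W → ZMod 2 :=
  fun w => ((Multiplicative.toAdd (w.1.valuationOfNeZero (K := twoDivisionAlgebra W) α) : ℤ) : ZMod 2)

/-- EXPLICIT UNRAMIFIED CLASS at `2`: the square class of `α` lies in `H¹_nr(ℚ₂, W[2]) = H¹(ℚ₂^nr/ℚ₂, W[2](ℚ₂^nr)) ⊂ ker N`, spelled out:
`N_{L/ℚ}(α) ∈ ℚ₂^{×2}` and `α ≡ 1 + 4t` modulo squares of `L_W ⊗ ℚ₂` for some `t ∈ 𝓞 L` — i.e. at every `w ∣ 2` the extension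
`L_w(√α)/L_w` is unramified (`L_w(√(1+4t)) = L_w(℘⁻¹(t̄))`), with `Σ_w e_w ε_w` even (the norm condition; `N(u_w) ≡ u_{ℚ₂}^{e_w}`).
`dim_{𝔽₂} = dim W(ℚ₂)[2]`. [folklore] -/
def IsExplicitUnramifiedClassAtTwo (W : WeierstrassCurve ℚ) [Fact (Irreducible (twoDivisionUCubic W))]
    [NumberField (twoDivisionAlgebra W)] (α : twoDivisionAlgebra W) : Prop :=
  IsSquare ((Algebra.norm ℚ α : ℚ) : ℚ_[2]) ∧
    ∃ t : 𝓞 (twoDivisionAlgebra W),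
      IsSquare ((α * (1 + 4 * (t : twoDivisionAlgebra W))) ⊗ₜ[ℚ] (1 : ℚ_[2]) : twoDivisionAlgebra W ⊗[ℚ] ℚ_[2])

/-- A finite family of elements of `L_W` is INDEPENDENT MODULO LOCAL SQUARES AT `2`: no non-empty sub-product is a square in `L_W ⊗ ℚ₂`
(i.e. the classes are `𝔽₂`-linearly independent in `(L_W ⊗ ℚ₂)^×/□`; a zero entry makes every sub-product through it a square, so such
families consist of units of `L_W ⊗ ℚ₂`). [folklore] -/
def LocSqIndependentAtTwo (W : WeierstrassCurve ℚ) {ι : Type} (β : ι → twoDivisionAlgebra W) : Prop :=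
  ∀ s : Finset ι, s.Nonempty → ¬ IsSquare ((∏ i ∈ s, β i) ⊗ₜ[ℚ] (1 : ℚ_[2]) : twoDivisionAlgebra W ⊗[ℚ] ℚ_[2])

/-- **DESC-§19-G (theorem-grade; the good-reduction clause of the local lemma).** `W(ℚ)[2] = 0`, `W` with GOOD reduction at `2`:
every local Kummer class above `2` is a UNIT class — for every `α ∈ L_W^×` whose square class lies in `δ₂(W(ℚ₂))`, `v_w(α)` is even at
every prime `w ∣ 2` of `𝓞 L_W`. Proof (MEMO-desc §19.2): `Φ₂ = 0`, so `H¹_nr(ℚ₂, W[2]) → H¹(ℚ₂, W)` factors through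
`H¹(ℚ₂^nr/ℚ₂, W(ℚ₂^nr)) = 0` (Lang; Milne ADT I.3.8), i.e. `H¹_nr ⊂ δ₂(W(ℚ₂))`; `δ₂(W(ℚ₂))` is maximal isotropic, hence
`δ₂(W(ℚ₂)) = δ₂(W(ℚ₂))^⊥ ⊂ H¹_nr^⊥ = {all `v_w` even}` (Hilbert symbols against the unramified classes `u_w`, `Σ_w e_w f_w = 3` odd).
CENSUS (BC5 witness): g10 kit j296051+j296388+j296834, 54 690 curves good at `2` (all with odd torsion, `N < 5·10⁵`): 54 690 / 54 690
Kummer bases above `2` consist of unit classes (engine A, `idealval`); g11 kit (two engines A = `idealval`, B = `ℚ₂`-factor norms): §19.4.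
For `v ∤ 2` odd and good this is Schaefer–Stoll 2004 Lemma 3.1; the `p = 2` clause is the one REF2 v16 §44(d) did not locate.
[cite: MilneADT2006, I.3.8] [cite: PoonenRains2012, Prop. 4.10 (arXiv:1009.0287)] [cite: SchaeferStoll2004, Lemma 3.1] -/
def KummerClassesAreUnitClassesAtGoodTwo : Prop :=
  ∀ (W : WeierstrassCurve ℚ) [W.IsElliptic] [Fact (Irreducible (twoDivisionUCubic W))] [NumberField (twoDivisionAlgebra W)],
    W.HasGoodReductionAtPrime 2 →
      ∀ α : (twoDivisionAlgebra W)ˣ, InExplicitLocalKummerImageAtTwo W 2 (α : twoDivisionAlgebra W) →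
        kummerParityVectorAtTwo W α = 0

/-- **DESC-§19-B (theorem-grade; the bound DESC-§18-P consumes at `p = 2`, all reduction types).** `W(ℚ)[2] = 0`: the `𝔽₂`-rank of the
valuation-parity vectors `(v_w(α) mod 2)_{w ∣ 2}` of the local Kummer image `δ₂(W(ℚ₂))` is at most
`min(dim_{𝔽₂} W(ℚ₂)[2], v₂(c₂(W)))` (`dim W(ℚ₂)[2] = #{w ∣ 2} − 1`; `v₂(c₂) ≥ dim H¹(𝔽₂, Φ₂)[2] = dim (Φ₂)_{Frob}/2`, the Frobenius COINVARIANTS — REF1 §67 n1). Typed: `k` parity vectors of Kummer classes that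
are `𝔽₂`-linearly independent number at most that bound. Proof: corollary of DESC-§19-X (`φ₂′ ≤ dim H¹(𝔽₂, W[2](ℚ₂^nr)) = dim W(ℚ₂)[2]` and
`φ₂′ ≤ dim H¹(𝔽₂, Φ₂)[2] = dim (Φ₂)_{Frob}/2(Φ₂)_{Frob} ≤ v₂(#(Φ₂)_{Frob}) = v₂(#Φ₂(𝔽₂)) = v₂(c₂)`; coinvariants, whose `2`-rank equals the invariants' `2`-rank for every group in the Kodaira–Néron list — REF1 §67 n1; the typed bound `v₂(c₂)` is safe either way since `dim A/2A ≤ v₂(#A)`). CENSUS (BC5 witness, g10 outputs re-read per prime by g11 `urcensus.py`, 211 885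
curves): rank `0` in ALL 136 604 curves with `v₂(c₂) = 0` and in ALL 10 294 curves with `W(ℚ₂)[2] = 0`, `v₂(c₂) ≥ 1` (0 exceptions); g11 kit
rank census (two engines): §19.4. WHY IT MIGHT FAIL: only through a slip in the Hilbert-symbol dictionary at `2` (step 3 of §19.2).
[cite: MilneADT2006, I.3.8] [cite: PoonenRains2012, Prop. 4.10 (arXiv:1009.0287)] [cite: BrumerKramer1977, §3] -/
def KummerParityRankLeAtTwo : Prop :=
  ∀ (W : WeierstrassCurve ℚ) [W.IsElliptic] [Fact (Irreducible (twoDivisionUCubic W))] [NumberField (twoDivisionAlgebra W)]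
    (k : ℕ) (α : Fin k → (twoDivisionAlgebra W)ˣ),
    (∀ i, InExplicitLocalKummerImageAtTwo W 2 (α i : twoDivisionAlgebra W)) →
      LinearIndependent (ZMod 2) (fun i => kummerParityVectorAtTwo W (α i)) →
        k ≤ min (Nat.card (PrimesOverTwo W) - 1) (padicValNat 2 ((W.baseChange ℚ_[2]).localTamagawaNumber ℤ_[2]))

/-- **DESC-§19-X (theorem-grade; the EXACT local formula, explicit duality form).** `W(ℚ)[2] = 0`, `K₂ = δ₂(W(ℚ₂))`, `N₂ = H¹_nr(ℚ₂, W[2])`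
(explicit: `IsExplicitUnramifiedClassAtTwo`), both inside `ker N ⊂ (L_W ⊗ ℚ₂)^×/□`: `rank_{𝔽₂} par(K₂) = dim_{𝔽₂}(K₂ + N₂) − dim K₂` with
`dim K₂ = dim W(ℚ₂)[2] + 1 = #{w ∣ 2}`; equivalently `= codim_{N₂}(K₂ ∩ N₂) = φ₂′(W) = dim Im(H¹(𝔽₂, W[2](ℚ₂^nr)) → H¹(𝔽₂, Φ₂))`.
Typed as: for every `k`, there are `k` Kummer classes with independent parity vectors iff there are `k + #{w ∣ 2}` classes of `K₂ ∪ N₂`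
independent modulo local squares. Proof (MEMO-desc §19.2): `K₂ ∩ N₂ = ker(N₂ → H¹(𝔽₂, Φ₂))` (Lang), `N₂^⊥ = Even` (Hilbert symbols),
`K₂ = K₂^⊥` (Tate), so `par(K₂) = par((K₂ ∩ N₂)^⊥)` has dimension `codim_{N₂}(K₂ ∩ N₂)`. Consequences checked against data: parity rank `0`
for non-split `I_{4m}` and for `I*_{2m+1}` with `c₂ = 2` although `Φ₂(𝔽₂)[2] ≠ 0` (g10 outputs: 2 299 resp. 4 225 curves at `2`, 0 exceptions),
and for multiplicative `I_n`: `φ₂′ = [2 ∣ n]·[q/2^n ≡ 1 (4)]·(split ? 1 : [n ≡ 2 (4)])` (`q` the Tate parameter). CENSUS (BC5 witness, g11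
kit, two engines for each side): §19.4. For `v ∤ 2` the formula reads `dim δ_v/(δ_v ∩ H¹_nr) = dim Im(Φ_v(𝔽_v) → Φ_v/2Φ_v)` (Schaefer–Stoll
2004, remark after Lemma 3.1); at `v ∣ 2` unramified ≠ unit class and the invariant is the `2`-torsion-visible part of `H¹(𝔽₂, Φ₂)`.
[cite: MilneADT2006, I.3.8] [cite: Mccallum1990] [cite: PoonenRains2012, Prop. 4.10 (arXiv:1009.0287)] [cite: SchaeferStoll2004, Lemma 3.1] -/
def KummerParityRankEqUnramifiedDefectAtTwo : Prop :=
  ∀ (W : WeierstrassCurve ℚ) [W.IsElliptic] [Fact (Irreducible (twoDivisionUCubic W))] [NumberField (twoDivisionAlgebra W)] (k : ℕ),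
    (∃ α : Fin k → (twoDivisionAlgebra W)ˣ,
        (∀ i, InExplicitLocalKummerImageAtTwo W 2 (α i : twoDivisionAlgebra W)) ∧
          LinearIndependent (ZMod 2) (fun i => kummerParityVectorAtTwo W (α i))) ↔
      ∃ β : Fin (k + Nat.card (PrimesOverTwo W)) → (twoDivisionAlgebra W)ˣ,
        (∀ i, InExplicitLocalKummerImageAtTwo W 2 (β i : twoDivisionAlgebra W) ∨
            IsExplicitUnramifiedClassAtTwo W (β i : twoDivisionAlgebra W)) ∧
          LocSqIndependentAtTwo W (fun i => (β i : twoDivisionAlgebra W))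

/-- **DESC-§19-N (theorem-grade; niceness symmetry — answers the shape of Yoo–Yu's question).** In the notation of Yoo–Yu (PJM 320 (2022),
Def. 1.5; `M_{1,v}` = classes `α` with `L_w(√α)/L_w` unramified for all `w ∣ v` and `N(α) ∈ K_v^{×2}` = `H¹_nr(K_v, W[2])`; `M_{2,v}` = classes with all
`w(α)` even): `W/ℚ` with `W(ℚ)[2] = 0` is LOWER NICE at `2` (`M_{1,2} ⊂ δ₂(W(ℚ₂))`) iff it is UPPER NICE at `2` (`δ₂(W(ℚ₂)) ⊂ M_{2,2}`), and both
hold iff `φ₂′(W) = 0`. Proof: `M_{2,v} = M_{1,v}^⊥` for the Tate pairing (sum of Hilbert symbols; `(u_w, β)_w = (−1)^{w(β)}`; dimensions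
`d + 2[K_v:ℚ₂]` on both sides) and `δ_v(W(K_v))` is its own orthogonal (Tate local duality), so `M₁ ⊂ δ ⟺ δ = δ^⊥ ⊂ M₁^⊥ = M₂`; the argument is
valid for every finite `K_v/ℚ₂` (and trivially for `v ∤ 2`, where `M₁ = M₂`). In print only sufficient conditions for (upper/lower) niceness at even
`v` are known — Brumer–Kramer 1977 (good reduction, `K_v/ℚ₂` unramified; = Yoo–Yu Thm 1.10), Barrera–Pacetti–Tornaría 2021 Thm 1.7 (†.i,ii),
Yoo–Yu 2022 Thm 1.11 — and Yoo–Yu ask (after Thm 1.11) how sharp they are; DESC-§19-X answers: nice ⟺ `φ′_v = 0`. CENSUS (BC5 witness): the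
engine's `dim(K₂+N₂) = dim K₂` test is literally `M₁ ⊂ δ₂`, and `rk = 0` is `δ₂ ⊂ M₂`; they coincide in every row of the g11 kit census (§19.4).
[cite: YooYu2022, Def. 1.5, Thm. 1.10, Thm. 1.11] [cite: BarrerasalazarPacettiTornaria2021, Thm. 1.7] [cite: PoonenRains2012, Prop. 4.10 (arXiv:1009.0287)] -/
def LowerNiceIffUpperNiceAtTwo : Prop :=
  ∀ (W : WeierstrassCurve ℚ) [W.IsElliptic] [Fact (Irreducible (twoDivisionUCubic W))] [NumberField (twoDivisionAlgebra W)],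
    (∀ α : (twoDivisionAlgebra W)ˣ, IsExplicitUnramifiedClassAtTwo W (α : twoDivisionAlgebra W) →
        InExplicitLocalKummerImageAtTwo W 2 (α : twoDivisionAlgebra W)) ↔
      (∀ α : (twoDivisionAlgebra W)ˣ, InExplicitLocalKummerImageAtTwo W 2 (α : twoDivisionAlgebra W) →
        kummerParityVectorAtTwo W α = 0)


/-! ## Proved bookkeeping (REF1-AUDIT §67 n2): DESC-§19-G is a formal corollary of DESC-§19-B in the tree -/

/-- **DESC-§19-G ⟸ DESC-§19-B (PROVED).** At good reduction the local Tamagawa number is `1` (tree theorem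
`WeierstrassCurve.localTamagawaNumber_eq_one_of_hasGoodReduction_holds`, Silverman AEC VII.2 / Tate's algorithm Step 1, applied to
`W/ℚ₂` over `ℤ₂` — `HasGoodReductionAtPrime 2` is literally its hypothesis), so the bound of DESC-§19-B is `min(·, v₂(1)) = 0`; a single
Kummer unit with a NON-ZERO parity vector is a `ZMod 2`-linearly independent family of size `1` (`linearIndependent_unique_iff`), and
`1 ≤ 0` is absurd. Nothing else is used; both sides stay plain `def`s (nothing asserted). -/
theorem kummerClassesAreUnitClassesAtGoodTwo_of_kummerParityRankLeAtTwo (hB : KummerParityRankLeAtTwo) :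
    KummerClassesAreUnitClassesAtGoodTwo := by
  intro W _ _ _ hgood α hα
  by_contra hne
  have hc : (W.baseChange ℚ_[2]).localTamagawaNumber ℤ_[2] = 1 := by
    haveI : ((W.baseChange ℚ_[2]).minimal ℤ_[2]).HasGoodReduction ℤ_[2] := hgood
    exact WeierstrassCurve.localTamagawaNumber_eq_one_of_hasGoodReduction_holds ℤ_[2] (W.baseChange ℚ_[2])
  have hli : LinearIndependent (ZMod 2) (fun _ : Fin 1 => kummerParityVectorAtTwo W α) :=
    linearIndependent_unique_iff.mpr hne
  have h := hB W 1 (fun _ => α) (fun _ => hα) hli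
  rw [hc, padicValNat_one_right] at h
  omega

end Summit.BirchSwinnertonDyer.Rank1Residual.F1Sign2

end
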